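import Literature.NumberTheory.EllipticCurves.EndomorphismRingTwoGenerated
import Literature.NumberTheory.EllipticCurves.CMTorsionTwistCharacterProofs
import Mathlib.GroupTheory.Archimedean
import HarnessLib

/-!
# `End_K(E)` is generated over `ℤ` by two elements — discharge of `endRing_twoGenerated`
# (Silverman, *AEC*, Cor. III.9.4)

Topic `NumberTheory/EllipticCurves`; a *proofs* file (D-0014: theorems only — no definition, no
named fact) for the statement file `EndomorphismRingTwoGenerated.lean`, whose named fact
`endRing_twoGenerated` («over a number field, `End_K(E) = ℤφ₁ + ℤφ₂` for some
`φ₁, φ₂ ∈ End_K(E)»`, the tree's transcription of Silverman, *AEC*, Cor. III.9.4: in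
characteristic `0`, `End(E)` is `ℤ` or an order in an imaginary quadratic field) is DISCHARGED
here: `endRing_twoGenerated_holds`.

THE PRINTED PROOF AND THE ROAD TAKEN. Cor. III.9.4 = Thm. III.9.3 (classification of `End(E)`
via the positive definite degree form, Cor. III.6.3) + Cor. III.5.6(c) (characteristic `0` ⇒
`End(E)` commutative). The tree PROVES these ingredients (`Literature/NumberTheory/EllipticCurves/`):
`WeierstrassCurve.exists_int_quadratic_of_mem_geomEndRing` (III.6.3: every `c ∈ End_{K̄}(E)` has
`c² − tc + d = 0`, `t, d ∈ ℤ`, with `m² + tmn + dn² > 0` for `m + nc ≠ 0`),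
`exists_intCast_mul_eq_of_mem_geomEndRing` (III.9.4, RATIONAL form: `ψ² = D < 0` ⇒ every `c`
has `N c = a + bψ`, `N ≠ 0`), `WeierstrassCurve.geomEndRing_comm_holds` (III.5.6(c)),
`WeierstrassCurve.isDomain_geomEndRing` / `charZero_geomEndRing` (III.§4). What remains is the
INTEGRALITY step «`End(E)` is an order, a lattice in `ℚ(ψ)`», done here by hand in the
commutative characteristic-`0` domain `End_{K̄}(E)` for any subring `L ⊆ End_{K̄}(E)`:
(1) `exists_generator_and_denominator_of_le_geomEndRing` — `L ⊆ ℤ`, or `ψ := 2c₀ − t ∈ L` has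
`ψ² = D < 0` and `2D·L ⊆ ℤ + ℤψ` (`exists_eq_intCast_of_intCast_mul_eq_intCast`,
`exists_two_mul_D_mul_mem_span`: gcd descents on `N c = a + bψ`, `c² = tc − d`);
(2) `exists_two_generators_addSubgroup_int_prod` — subgroups of `ℤ × ℤ` are two-generated;
(3) `exists_two_generators_of_le_geomEndRing` — apply (2) to `{(m, n) | m + nψ ∈ M·L}`, cancel `M`.
This proves the statement for EVERY field of characteristic `0` (`exists_two_generators_endRing`,
the statement file's «TODO(general form)» in `ℤ`-span shape); the number-field case is the named
fact. (The summit-side `EndRankTwo.exists_generator_endRing` has only the rational form and is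
not importable into Literature; its generator construction is re-derived here.)

## References

* [SilvermanAEC2009] J. H. Silverman, *The Arithmetic of Elliptic Curves*, 2nd ed., GTM 106
  (2009): Cor. III.9.4 and Remark III.9.4.1, Thm. III.9.3, Cor. III.6.3, Cor. III.5.6(c), III.§4.
* [Lang1987] S. Lang, *Elliptic Functions*, 2nd ed., GTM 112 (1987), Ch. 13 §2.

Design: theorems only, `W` explicit, path namespace (as the sibling proofs files); ring
identities are computed in the subring type `W.geomEndRing` under a LOCAL `CommRing` structure
(`letI` from `geomEndRing_comm_holds`; no instance) and pushed down to `AddMonoid.End E(K̄)`.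
-/

noncomputable section

open scoped Classical

namespace Literature.NumberTheory.EllipticCurves

-- `_root_`: some import closures declare `Literature.NumberTheory.EllipticCurves.WeierstrassCurve.*`
open _root_.WeierstrassCurve

universe u

/-! ## Subgroups of `ℤ × ℤ` are generated by two elements -/

/-- **Every subgroup `H` of `ℤ × ℤ` is generated by two of its elements** `h₁, h₂` (the second
projection of `H` is `ℤk` — `Int.subgroup_cyclic` —, `h₂ ∈ H` lies over `k`, and the elements
of `H` with second coordinate `0` form `ℤ(n, 0) = ℤh₁`); a private helper. [folklore] -/
private theorem exists_two_generators_addSubgroup_int_prod (H : AddSubgroup (ℤ × ℤ)) :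
    ∃ h₁ ∈ H, ∃ h₂ ∈ H, ∀ h ∈ H, ∃ α β : ℤ, h = α • h₁ + β • h₂ := by
  obtain ⟨k, hk⟩ := Int.subgroup_cyclic (H.map (AddMonoidHom.snd ℤ ℤ))
  obtain ⟨n, hn⟩ := Int.subgroup_cyclic (H.comap (AddMonoidHom.inl ℤ ℤ))
  have hk' : k ∈ H.map (AddMonoidHom.snd ℤ ℤ) := by
    rw [hk]; exact AddSubgroup.subset_closure (Set.mem_singleton k)
  obtain ⟨h₂, hh₂, hh₂k⟩ := AddSubgroup.mem_map.mp hk'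
  rw [AddMonoidHom.coe_snd] at hh₂k
  have hn' : n ∈ H.comap (AddMonoidHom.inl ℤ ℤ) := by
    rw [hn]; exact AddSubgroup.subset_closure (Set.mem_singleton n)
  refine ⟨(n, 0), (AddSubgroup.mem_comap.mp hn' :), h₂, hh₂, fun h hh ↦ ?_⟩
  have h2 : h.2 ∈ H.map (AddMonoidHom.snd ℤ ℤ) := AddSubgroup.mem_map.mpr ⟨h, hh, rfl⟩
  rw [hk, AddSubgroup.mem_closure_singleton] at h2
  obtain ⟨β, hβ⟩ := h2
  rw [smul_eq_mul] at hβ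
  have h1 : h.1 - β * h₂.1 ∈ H.comap (AddMonoidHom.inl ℤ ℤ) := by
    rw [AddSubgroup.mem_comap]
    have e : (AddMonoidHom.inl ℤ ℤ) (h.1 - β * h₂.1) = h - β • h₂ := by
      refine Prod.ext ?_ ?_
      · simp only [AddMonoidHom.inl_apply, Prod.fst_sub, Prod.smul_fst, smul_eq_mul]
      · simp only [AddMonoidHom.inl_apply, Prod.snd_sub, Prod.smul_snd, smul_eq_mul, hh₂k, hβ,
          sub_self]
    rw [e]
    exact H.sub_mem hh (H.zsmul_mem hh₂ β)
  rw [hn, AddSubgroup.mem_closure_singleton] at h1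
  obtain ⟨α, hα⟩ := h1
  rw [smul_eq_mul] at hα
  refine ⟨α, β, Prod.ext ?_ ?_⟩
  · simp only [Prod.fst_add, Prod.smul_fst, smul_eq_mul]
    linarith
  · simp only [Prod.snd_add, Prod.smul_snd, smul_eq_mul, mul_zero, zero_add, hh₂k, hβ]

/-! ## Arithmetic in the characteristic-`0` domain `End_{K̄}(E)` -/

section GeomEndRing

variable {K : Type u} [Field K] (W : WeierstrassCurve K) [W.IsElliptic]

/-- **Cancellation of non-zero integers in `End_{K̄}(E)`**: `N ≠ 0`, `N·x = 0` in `W.geomEndRing`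
⇒ `x = 0` — `End_{K̄}(E)` is a domain of characteristic `0` (`WeierstrassCurve.isDomain_geomEndRing`,
`WeierstrassCurve.charZero_geomEndRing`). [cite: SilvermanAEC2009, Prop. III.4.2(b),(c)] -/
theorem geomEndRing_eq_zero_of_intCast_mul_eq_zero {x : W.geomEndRing} {N : ℤ} (hN : N ≠ 0)
    (h : (N : W.geomEndRing) * x = 0) : x = 0 := by
  haveI := isDomain_geomEndRing W
  haveI := charZero_geomEndRing W
  exact (mul_eq_zero.mp h).resolve_left (Int.cast_ne_zero.mpr hN)

/-- **`ℤ → End_{K̄}(E)` is injective** (`WeierstrassCurve.charZero_geomEndRing`: `[n] ≠ 0` for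
`n ≠ 0`). [cite: SilvermanAEC2009, Prop. III.4.2(b)] -/
theorem geomEndRing_intCast_injective :
    Function.Injective (Int.cast : ℤ → W.geomEndRing) := by
  haveI := charZero_geomEndRing W
  exact Int.cast_injective

variable [CharZero K]

/-- **An element of `End_{K̄}(E)` commensurable with a scalar is a scalar** (`End(E) ∩ ℚ = ℤ`).
If `c ∈ End_{K̄}(E)`, `N c = a`, `N ≠ 0`, then `c = m ∈ ℤ`: from `c² = tc − d` (Cor. III.6.3) and
`N = gN'`, `a = ga'`, `gcd(a', N') = 1` one gets `N'c = a'`, `a'² = N'(ta' − dN')`, `N' = ±1`.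
[cite: SilvermanAEC2009, Cor. III.9.4 and Cor. III.6.3] -/
theorem exists_eq_intCast_of_intCast_mul_eq_intCast {c : AddMonoid.End W.geomPoints}
    (hc : c ∈ W.geomEndRing) {N a : ℤ} (hN : N ≠ 0)
    (h : (N : AddMonoid.End W.geomPoints) * c = a) :
    ∃ m : ℤ, c = (m : AddMonoid.End W.geomPoints) := by
  obtain ⟨t, d, hquad, -⟩ := W.exists_int_quadratic_of_mem_geomEndRing hc
  obtain ⟨g, a', N', hg, hcop, ha, hN'⟩ := Int.exists_gcd_one' (Int.gcd_pos_of_ne_zero_right a hN)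
  have hg0 : (g : ℤ) ≠ 0 := by exact_mod_cast hg.ne'
  letI : CommRing W.geomEndRing :=
    { (inferInstance : Ring W.geomEndRing) with
      mul_comm := fun x y ↦ Subtype.ext (W.geomEndRing_comm_holds _ _ x.2 y.2) }
  set x : W.geomEndRing := ⟨c, hc⟩
  have h1 : x * x - (t : W.geomEndRing) * x + (d : W.geomEndRing) = 0 :=
    Subtype.ext (by push_cast; exact hquad)
  have h2 : (N : W.geomEndRing) * x = (a : W.geomEndRing) := Subtype.ext (by push_cast; exact h)
  have h3 : ((g : ℤ) : W.geomEndRing) * ((N' : W.geomEndRing) * x - (a' : W.geomEndRing)) = 0 := by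
    have eN : ((N : ℤ) : W.geomEndRing) = ((N' * g : ℤ) : W.geomEndRing) := by rw [hN']
    have ea : ((a : ℤ) : W.geomEndRing) = ((a' * g : ℤ) : W.geomEndRing) := by rw [ha]
    push_cast at eN ea ⊢
    linear_combination h2 - x * eN + ea
  have h4 : (N' : W.geomEndRing) * x = (a' : W.geomEndRing) :=
    sub_eq_zero.mp (geomEndRing_eq_zero_of_intCast_mul_eq_zero W hg0 h3)
  have h5 : ((a' ^ 2 : ℤ) : W.geomEndRing) = ((N' * (t * a' - d * N') : ℤ) : W.geomEndRing) := by
    push_cast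
    linear_combination (N' : W.geomEndRing) ^ 2 * h1
      - ((a' : W.geomEndRing) + (N' : W.geomEndRing) * x - t * N') * h4
  have h6 : a' ^ 2 = N' * (t * a' - d * N') := geomEndRing_intCast_injective W h5
  have hunit : IsUnit N' :=
    ((Int.isCoprime_iff_gcd_eq_one.mpr hcop).pow_left (m := 2)).isUnit_of_dvd'
      (Dvd.intro _ h6.symm) (dvd_refl N')
  have e := congrArg Subtype.val h4
  simp only [Subring.coe_mul, SubringClass.coe_intCast] at e
  change (N' : AddMonoid.End W.geomPoints) * c = (a' : AddMonoid.End W.geomPoints) at e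
  rcases Int.isUnit_iff.mp hunit with h7 | h7
  · refine ⟨a', ?_⟩
    rwa [h7, Int.cast_one, one_mul] at e
  · refine ⟨-a', ?_⟩
    rw [h7, Int.cast_neg, Int.cast_one, neg_one_mul, neg_eq_iff_eq_neg] at e
    rw [e, Int.cast_neg]

/-- **`ψ` with `ψ² = D < 0` is irrational**: if `ψ ∈ End_{K̄}(E)`, `ψ² = D < 0` and `Bψ = S` with
integers `B`, `S`, then `B = 0` (else `B²D = S² ≥ 0`). [cite: SilvermanAEC2009, Cor. III.9.4] -/
theorem eq_zero_of_intCast_mul_eq_intCast {ψ : AddMonoid.End W.geomPoints} (hψ : ψ ∈ W.geomEndRing)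
    {D : ℤ} (hD : D < 0) (hψψ : ψ * ψ = (D : AddMonoid.End W.geomPoints)) {B S : ℤ}
    (h : (B : AddMonoid.End W.geomPoints) * ψ = S) : B = 0 := by
  by_contra hB
  letI : CommRing W.geomEndRing :=
    { (inferInstance : Ring W.geomEndRing) with
      mul_comm := fun x y ↦ Subtype.ext (W.geomEndRing_comm_holds _ _ x.2 y.2) }
  set y : W.geomEndRing := ⟨ψ, hψ⟩
  have h1 : y * y = (D : W.geomEndRing) := Subtype.ext (by push_cast; exact hψψ)
  have h2 : (B : W.geomEndRing) * y = (S : W.geomEndRing) := Subtype.ext (by push_cast; exact h)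
  have h3 : ((B ^ 2 * D : ℤ) : W.geomEndRing) = ((S ^ 2 : ℤ) : W.geomEndRing) := by
    push_cast
    linear_combination ((B : W.geomEndRing) * y + S) * h2 - (B : W.geomEndRing) ^ 2 * h1
  have h4 : B ^ 2 * D = S ^ 2 := geomEndRing_intCast_injective W h3
  have hB2 : 0 < B ^ 2 := lt_of_le_of_ne (sq_nonneg B) (Ne.symm (pow_ne_zero 2 hB))
  have h5 : B ^ 2 * D < 0 := mul_neg_of_pos_of_neg hB2 hD
  rw [h4] at h5
  exact absurd h5 (not_lt.mpr (sq_nonneg S))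

/-- **Uniform denominator `2D` («`End(E)` is an order in `ℚ(ψ)`»).** If `ψ, c ∈ End_{K̄}(E)`,
`ψ² = D < 0`, `N c = a + bψ` with `N ≠ 0` (rational form of Cor. III.9.4), then `2D·c = m + nψ`
for integers `m, n`: with `c² = tc − d` (Cor. III.6.3) the two expressions for `N²c²` give
`b(2a − tN)ψ ∈ ℤ`, so `b = 0` (then `c ∈ ℤ`) or `2a = tN`, `N(2c − t) = 2bψ`; dividing by
`gcd(N, 2b)`, `N₁²(t² − 4d) = b₁²D` with `gcd(N₁, b₁) = 1`, so `N₁² ∣ D`, `2D·c = Dt + (D/N₁)b₁ψ`.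
[cite: SilvermanAEC2009, Cor. III.9.4 and Cor. III.6.3] -/
theorem exists_two_mul_D_mul_mem_span {ψ : AddMonoid.End W.geomPoints} (hψ : ψ ∈ W.geomEndRing)
    {D : ℤ} (hD : D < 0) (hψψ : ψ * ψ = (D : AddMonoid.End W.geomPoints))
    {c : AddMonoid.End W.geomPoints} (hc : c ∈ W.geomEndRing) {N a b : ℤ} (hN : N ≠ 0)
    (h : (N : AddMonoid.End W.geomPoints) * c =
      (a : AddMonoid.End W.geomPoints) + (b : AddMonoid.End W.geomPoints) * ψ) :
    ∃ m n : ℤ, ((2 * D : ℤ) : AddMonoid.End W.geomPoints) * c =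
      (m : AddMonoid.End W.geomPoints) + (n : AddMonoid.End W.geomPoints) * ψ := by
  obtain ⟨t, d, hquad, -⟩ := W.exists_int_quadratic_of_mem_geomEndRing hc
  letI : CommRing W.geomEndRing :=
    { (inferInstance : Ring W.geomEndRing) with
      mul_comm := fun x y ↦ Subtype.ext (W.geomEndRing_comm_holds _ _ x.2 y.2) }
  set x : W.geomEndRing := ⟨c, hc⟩
  set y : W.geomEndRing := ⟨ψ, hψ⟩
  have h1 : x * x - (t : W.geomEndRing) * x + (d : W.geomEndRing) = 0 :=
    Subtype.ext (by push_cast; exact hquad)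
  have h2 : (N : W.geomEndRing) * x = (a : W.geomEndRing) + (b : W.geomEndRing) * y :=
    Subtype.ext (by push_cast; exact h)
  have h3 : y * y = (D : W.geomEndRing) := Subtype.ext (by push_cast; exact hψψ)
  -- `b (2a - tN) ψ = tNa - dN² - a² - b²D`, hence `b (2a - tN) = 0`
  have key : ((b * (2 * a - t * N) : ℤ) : W.geomEndRing) * y =
      ((t * N * a - d * N ^ 2 - a ^ 2 - b ^ 2 * D : ℤ) : W.geomEndRing) := by
    push_cast
    linear_combination (N : W.geomEndRing) ^ 2 * h1
      - ((N : W.geomEndRing) * x + a + b * y - t * N) * h2 - (b : W.geomEndRing) ^ 2 * h3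
  have key' : ((b * (2 * a - t * N) : ℤ) : AddMonoid.End W.geomPoints) * ψ =
      ((t * N * a - d * N ^ 2 - a ^ 2 - b ^ 2 * D : ℤ) : AddMonoid.End W.geomPoints) := by
    have := congrArg Subtype.val key
    simpa only [Subring.coe_mul, SubringClass.coe_intCast] using this
  rcases mul_eq_zero.mp (eq_zero_of_intCast_mul_eq_intCast W hψ hD hψψ key') with hb | hb
  · -- `b = 0`: `c` is commensurable with a scalar, hence an integer
    subst hb
    have h' : (N : AddMonoid.End W.geomPoints) * c = a := by
      rw [h, Int.cast_zero, zero_mul, add_zero]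
    obtain ⟨m, hm⟩ := exists_eq_intCast_of_intCast_mul_eq_intCast W hc hN h'
    refine ⟨2 * D * m, 0, ?_⟩
    rw [hm]; push_cast; rw [zero_mul, add_zero]
  · -- `2a = tN`: `N (2c - t) = 2b ψ`, `(2c - t)² = t² - 4d`
    have hb' : ((2 * a : ℤ) : W.geomEndRing) = ((t * N : ℤ) : W.geomEndRing) := by
      rw [sub_eq_zero.mp hb]
    push_cast at hb'
    have hu : (N : W.geomEndRing) * (2 * x - t) = ((2 * b : ℤ) : W.geomEndRing) * y := by
      push_cast
      linear_combination 2 * h2 + hb'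
    have hu2 : (2 * x - (t : W.geomEndRing)) * (2 * x - t) =
        ((t ^ 2 - 4 * d : ℤ) : W.geomEndRing) := by
      push_cast
      linear_combination 4 * h1
    obtain ⟨g, N₁, b₁, hg, hcop, hN₁, hb₁⟩ :=
      Int.exists_gcd_one' (Int.gcd_pos_of_ne_zero_left (2 * b) hN)
    have hg0 : (g : ℤ) ≠ 0 := by exact_mod_cast hg.ne'
    have hu3 : ((g : ℤ) : W.geomEndRing) *
        ((N₁ : W.geomEndRing) * (2 * x - t) - (b₁ : W.geomEndRing) * y) = 0 := by
      have eN : ((N : ℤ) : W.geomEndRing) = ((N₁ * g : ℤ) : W.geomEndRing) := by rw [hN₁]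
      have eb : ((2 * b : ℤ) : W.geomEndRing) = ((b₁ * g : ℤ) : W.geomEndRing) := by rw [hb₁]
      push_cast at eN eb hu ⊢
      linear_combination hu - (2 * x - (t : W.geomEndRing)) * eN + y * eb
    have hu4 : (N₁ : W.geomEndRing) * (2 * x - t) = (b₁ : W.geomEndRing) * y :=
      sub_eq_zero.mp (geomEndRing_eq_zero_of_intCast_mul_eq_zero W hg0 hu3)
    -- `N₁² (t² - 4d) = b₁² D`, so `N₁² ∣ D`
    have h5 : ((N₁ ^ 2 * (t ^ 2 - 4 * d) : ℤ) : W.geomEndRing) =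
        ((b₁ ^ 2 * D : ℤ) : W.geomEndRing) := by
      push_cast
      push_cast at hu2
      linear_combination ((N₁ : W.geomEndRing) * (2 * x - t) + b₁ * y) * hu4
        + (b₁ : W.geomEndRing) ^ 2 * h3 - (N₁ : W.geomEndRing) ^ 2 * hu2
    have h6 : N₁ ^ 2 * (t ^ 2 - 4 * d) = b₁ ^ 2 * D := geomEndRing_intCast_injective W h5
    have hcop' : IsCoprime (N₁ ^ 2) (b₁ ^ 2) := (Int.isCoprime_iff_gcd_eq_one.mpr hcop).pow
    obtain ⟨e, he⟩ : N₁ ^ 2 ∣ D := hcop'.dvd_of_dvd_mul_left (Dvd.intro _ h6)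
    refine ⟨D * t, N₁ * e * b₁, ?_⟩
    have key2 : ((2 * D : ℤ) : W.geomEndRing) * x =
        ((D * t : ℤ) : W.geomEndRing) + ((N₁ * e * b₁ : ℤ) : W.geomEndRing) * y := by
      have he' : ((D : ℤ) : W.geomEndRing) = ((N₁ ^ 2 * e : ℤ) : W.geomEndRing) := by rw [he]
      push_cast at he' ⊢
      linear_combination (2 * x - (t : W.geomEndRing)) * he' + (N₁ : W.geomEndRing) * e * hu4
    have := congrArg Subtype.val key2
    simpa only [Subring.coe_mul, Subring.coe_add, SubringClass.coe_intCast] using this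

/-- **One generator and one denominator for a subring `L ⊆ End_{K̄}(E)`** (characteristic
`0`): there are `ψ ∈ L` and `M ≠ 0` with `M·L ⊆ ℤ + ℤψ`. Either every `c ∈ L` is commensurable
with a scalar — then `L ⊆ ℤ` (`exists_eq_intCast_of_intCast_mul_eq_intCast`), `ψ = 0`, `M = 1` —
or some `c₀ ∈ L` is not: `c₀² − tc₀ + d = 0` (Cor. III.6.3), `ψ := 2c₀ − t ∈ L` has
`ψ² = t² − 4d < 0` (positivity of `m² + tmn + dn²` at `(t, −2)`), and Cor. III.9.4
(`exists_intCast_mul_eq_of_mem_geomEndRing`) with `exists_two_mul_D_mul_mem_span` gives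
`M = 2(t² − 4d)`. [cite: SilvermanAEC2009, Cor. III.9.4 and Cor. III.6.3] -/
theorem exists_generator_and_denominator_of_le_geomEndRing
    (L : Subring (AddMonoid.End W.geomPoints)) (hL : L ≤ W.geomEndRing) :
    ∃ ψ ∈ L, ∃ M : ℤ, M ≠ 0 ∧ ∀ c ∈ L, ∃ m n : ℤ,
      (M : AddMonoid.End W.geomPoints) * c =
        (m : AddMonoid.End W.geomPoints) + (n : AddMonoid.End W.geomPoints) * ψ := by
  by_cases hsc : ∀ c ∈ L, ∃ N a : ℤ, N ≠ 0 ∧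
      (N : AddMonoid.End W.geomPoints) * c = (a : AddMonoid.End W.geomPoints)
  · refine ⟨0, L.zero_mem, 1, one_ne_zero, fun c hc ↦ ?_⟩
    obtain ⟨N, a, hN, h⟩ := hsc c hc
    obtain ⟨m, hm⟩ := exists_eq_intCast_of_intCast_mul_eq_intCast W (hL hc) hN h
    exact ⟨m, 0, by rw [hm, Int.cast_one, one_mul, Int.cast_zero, zero_mul, add_zero]⟩
  · push Not at hsc
    obtain ⟨c₀, hc₀, hns⟩ := hsc
    obtain ⟨t, d, hquad, hpos⟩ := W.exists_int_quadratic_of_mem_geomEndRing (hL hc₀)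
    have h2 : ((2 : ℤ) : AddMonoid.End W.geomPoints) = 2 := by push_cast; rfl
    have hψmem : (2 : AddMonoid.End W.geomPoints) * c₀ - (t : AddMonoid.End W.geomPoints) ∈ L :=
      L.sub_mem (L.mul_mem (by rw [← h2]; exact intCast_mem L 2) hc₀) (intCast_mem L t)
    have hne : (t : AddMonoid.End W.geomPoints) +
        ((-2 : ℤ) : AddMonoid.End W.geomPoints) * c₀ ≠ 0 := by
      intro h0
      apply hns 2 t two_ne_zero
      have e : ((-2 : ℤ) : AddMonoid.End W.geomPoints) =
          -((2 : ℤ) : AddMonoid.End W.geomPoints) := by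
        push_cast; rfl
      rw [e, neg_mul, ← sub_eq_add_neg, sub_eq_zero] at h0
      exact h0.symm
    have hD : t ^ 2 - 4 * d < 0 := by
      have h := hpos t (-2) hne
      nlinarith
    letI : CommRing W.geomEndRing :=
      { (inferInstance : Ring W.geomEndRing) with
        mul_comm := fun x y ↦ Subtype.ext (W.geomEndRing_comm_holds _ _ x.2 y.2) }
    set x₀ : W.geomEndRing := ⟨c₀, hL hc₀⟩
    have h1 : x₀ * x₀ - (t : W.geomEndRing) * x₀ + (d : W.geomEndRing) = 0 :=
      Subtype.ext (by push_cast; exact hquad)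
    have hψψ' : ((2 : W.geomEndRing) * x₀ - (t : W.geomEndRing)) * ((2 : W.geomEndRing) * x₀ - t) =
        ((t ^ 2 - 4 * d : ℤ) : W.geomEndRing) := by
      push_cast
      linear_combination (4 : W.geomEndRing) * h1
    have hψψ : ((2 : AddMonoid.End W.geomPoints) * c₀ - (t : AddMonoid.End W.geomPoints)) *
        ((2 : AddMonoid.End W.geomPoints) * c₀ - (t : AddMonoid.End W.geomPoints)) =
          ((t ^ 2 - 4 * d : ℤ) : AddMonoid.End W.geomPoints) := by
      have := congrArg Subtype.val hψψ'; push_cast at this ⊢; exact this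
    refine ⟨(2 : AddMonoid.End W.geomPoints) * c₀ - (t : AddMonoid.End W.geomPoints), hψmem,
      2 * (t ^ 2 - 4 * d), mul_ne_zero two_ne_zero hD.ne, fun c hc ↦ ?_⟩
    obtain ⟨N, a, b, hN, h⟩ :=
      exists_intCast_mul_eq_of_mem_geomEndRing W (hL hψmem) hD hψψ (hL hc)
    exact exists_two_mul_D_mul_mem_span W (hL hψmem) hD hψψ (hL hc) hN h

/-- **Every subring `L` of `End_{K̄}(E)` is generated over `ℤ` by two of its elements**
(characteristic `0`; `L = End_{K̄}(E)` is Silverman, *AEC*, Cor. III.9.4: «`End(E)` is `ℤ` or an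
order in an imaginary quadratic field», a free `ℤ`-module of rank `≤ 2`). With `ψ ∈ L`, `M ≠ 0`,
`M·L ⊆ ℤ + ℤψ` (`exists_generator_and_denominator_of_le_geomEndRing`), the subgroup
`{(m, n) ∈ ℤ² | m + nψ ∈ M·L}` is generated by some `M·φ₁`, `M·φ₂`
(`exists_two_generators_addSubgroup_int_prod`), and `M` cancels in the domain `End_{K̄}(E)`.
[cite: SilvermanAEC2009, Cor. III.9.4 and Remark III.9.4.1] -/
theorem exists_two_generators_of_le_geomEndRing
    (L : Subring (AddMonoid.End W.geomPoints)) (hL : L ≤ W.geomEndRing) :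
    ∃ φ₁ ∈ L, ∃ φ₂ ∈ L, ∀ φ ∈ L, ∃ a b : ℤ, φ = a • φ₁ + b • φ₂ := by
  obtain ⟨ψ, hψ, M, hM, hall⟩ := exists_generator_and_denominator_of_le_geomEndRing W L hL
  let H : AddSubgroup (ℤ × ℤ) :=
    { carrier := {v | ∃ c ∈ L, (M : AddMonoid.End W.geomPoints) * c =
        (v.1 : AddMonoid.End W.geomPoints) + (v.2 : AddMonoid.End W.geomPoints) * ψ}
      add_mem' := by
        rintro v w ⟨c, hc, hvc⟩ ⟨c', hc', hwc⟩
        refine ⟨c + c', L.add_mem hc hc', ?_⟩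
        rw [mul_add, hvc, hwc, Prod.fst_add, Prod.snd_add, Int.cast_add, Int.cast_add, add_mul]
        abel
      zero_mem' := ⟨0, L.zero_mem, by simp⟩
      neg_mem' := by
        rintro v ⟨c, hc, hvc⟩
        refine ⟨-c, L.neg_mem hc, ?_⟩
        rw [mul_neg, hvc, Prod.fst_neg, Prod.snd_neg, Int.cast_neg, Int.cast_neg, neg_add,
          neg_mul] }
  obtain ⟨h₁, ⟨c₁, hc₁, hc₁eq⟩, h₂, ⟨c₂, hc₂, hc₂eq⟩, hgen⟩ :=
    exists_two_generators_addSubgroup_int_prod H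
  refine ⟨c₁, hc₁, c₂, hc₂, fun φ hφ ↦ ?_⟩
  obtain ⟨m, n, hmn⟩ := hall φ hφ
  obtain ⟨α, β, hαβ⟩ := hgen (m, n) ⟨φ, hφ, hmn⟩
  refine ⟨α, β, ?_⟩
  obtain ⟨hm, hn⟩ := Prod.ext_iff.mp hαβ
  simp only [Prod.fst_add, Prod.snd_add, Prod.smul_fst, Prod.smul_snd, smul_eq_mul] at hm hn
  letI : CommRing W.geomEndRing :=
    { (inferInstance : Ring W.geomEndRing) with
      mul_comm := fun x y ↦ Subtype.ext (W.geomEndRing_comm_holds _ _ x.2 y.2) }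
  set x : W.geomEndRing := ⟨φ, hL hφ⟩
  set x₁ : W.geomEndRing := ⟨c₁, hL hc₁⟩
  set x₂ : W.geomEndRing := ⟨c₂, hL hc₂⟩
  set y : W.geomEndRing := ⟨ψ, hL hψ⟩
  have e0 : (M : W.geomEndRing) * x = (m : W.geomEndRing) + (n : W.geomEndRing) * y :=
    Subtype.ext (by push_cast; exact hmn)
  have e1 : (M : W.geomEndRing) * x₁ = (h₁.1 : W.geomEndRing) + (h₁.2 : W.geomEndRing) * y :=
    Subtype.ext (by push_cast; exact hc₁eq)
  have e2 : (M : W.geomEndRing) * x₂ = (h₂.1 : W.geomEndRing) + (h₂.2 : W.geomEndRing) * y :=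
    Subtype.ext (by push_cast; exact hc₂eq)
  have em : ((m : ℤ) : W.geomEndRing) = ((α * h₁.1 + β * h₂.1 : ℤ) : W.geomEndRing) := by rw [hm]
  have en : ((n : ℤ) : W.geomEndRing) = ((α * h₁.2 + β * h₂.2 : ℤ) : W.geomEndRing) := by rw [hn]
  push_cast at em en
  have key : (M : W.geomEndRing) *
      (x - ((α : W.geomEndRing) * x₁ + (β : W.geomEndRing) * x₂)) = 0 := by
    linear_combination e0 - (α : W.geomEndRing) * e1 - (β : W.geomEndRing) * e2 + em + y * en
  have key' : x = (α : W.geomEndRing) * x₁ + (β : W.geomEndRing) * x₂ :=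
    sub_eq_zero.mp (geomEndRing_eq_zero_of_intCast_mul_eq_zero W hM key)
  have := congrArg Subtype.val key'
  rw [zsmul_eq_mul, zsmul_eq_mul]; push_cast at this; exact this

/-- **`End_K(E)` is generated over `ℤ` by two elements**, for an elliptic curve over ANY field
of characteristic `0`: there are `φ₁, φ₂ ∈ End_K(E)` (`WeierstrassCurve.endRing`) with every
`φ ∈ End_K(E)` equal to `aφ₁ + bφ₂`, `a, b ∈ ℤ` — Cor. III.9.4 for the subring
`End_K(E) ⊆ End_{K̄}(E)`; the statement file's «TODO(general form)» in `ℤ`-span shape.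
[cite: SilvermanAEC2009, Cor. III.9.4 and Remark III.9.4.1] -/
theorem exists_two_generators_endRing :
    ∃ φ₁ ∈ W.endRing, ∃ φ₂ ∈ W.endRing, ∀ φ ∈ W.endRing, ∃ a b : ℤ, φ = a • φ₁ + b • φ₂ :=
  exists_two_generators_of_le_geomEndRing W W.endRing W.endRing_le_geomEndRing

end GeomEndRing

/-! ## The discharge -/

/-- **Discharge of the named fact `endRing_twoGenerated`** (Silverman, *AEC*, Cor. III.9.4,
number-field case): for an elliptic curve `E` over a number field `K` there are
`φ₁, φ₂ ∈ End_K(E)` such that every `φ ∈ End_K(E)` is `aφ₁ + bφ₂` with `a, b ∈ ℤ` — the case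
`CharZero K` of `exists_two_generators_endRing`. [cite: SilvermanAEC2009, Cor. III.9.4 and Remark III.9.4.1] -/
theorem endRing_twoGenerated_holds : endRing_twoGenerated :=
  fun _K _ _ W _ ↦ exists_two_generators_endRing W

end Literature.NumberTheory.EllipticCurves
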